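import Summits.CriticalPhenomena.PercolationContinuityZ3.Theorems.PercNearOneGluingNoHeavyPcintBSMXDisp
import HarnessLib

/-!
# PCINT lane, PHASE 6 (block renewal with reach-two pieces): square-root-free data for two time axes

Cell `prim-pcint`, seat `prim-pcint-1` (gen 15); memo `run/shared/lean/prim/pcint/T-FIBRE-ROUTE.md` §PHASE 6.

For the long horizons of the `ℤ⁴` instance (two time axes) neither the tree's rational table `OSM.vrow 2 N` nor an
iterated list of central binomials fits in one kernel check.  Instead the oriented meeting probability is bounded by
the tree's central binomial estimate `C(2i,i)² (3i+1) ≤ 16ⁱ`, i.e. **`u 2 i ² ≤ 1/(3i+1)`** (`BSMX.u_two_sq_le`; the loss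
against the exact value tends to `√(π/3) - 1 ≈ 2.3 %`), which is checked coefficient-wise in the square
(`DU² ≤ U_i² (3i+1)`, **`BSMX.u_two_hybrid`**: exact values from `OSM.vrow` below a cut `M`, the estimate beyond;
`cadj 2 i ≤ u 2 i` for the adjacent class, **`BSMX.cadj_two_hybrid`**), and likewise in the two-axes tail
(**`BSMX.tailBoundH_of_twoSqQ`**: `X² ≤ (Tn/DG)² (3N+1)` with `X = (2N+2)/((2N+1)8a₁) + r^{2M}/(2(1-r²))`, `M ≤ N`).
-/

noncomputable section

namespace Summit.CriticalPhenomena.PercolationContinuityZ3.Theorems.Pcint.BSMX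

open Finset OSM BSM

variable {t : ℕ}

/-- **`u 2 i ² ≤ 1/(3i+1)`.** -/
theorem u_two_sq_le (i : ℕ) : u 2 i ^ 2 ≤ 1 / (3 * (i : ℝ) + 1) := by
  rw [u_two_eq]
  have h := centralBinom_sq_mul_le i
  have h' : ((Nat.centralBinom i : ℝ)) ^ 2 * (3 * (i : ℝ) + 1) ≤ (16 : ℝ) ^ i := by exact_mod_cast h
  rw [div_pow, div_le_div_iff₀ (by positivity) (by positivity), one_mul]
  have : ((4 : ℝ) ^ i) ^ 2 = (16 : ℝ) ^ i := by rw [← pow_mul, mul_comm, pow_mul]; norm_num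
  rw [this]
  exact h'

/-- From the squared check `DU² ≤ U² (3i+1)` to `u 2 i · DU ≤ U`. -/
theorem u_two_le_of_sq {i DU U : ℕ} (h : DU ^ 2 ≤ U ^ 2 * (3 * i + 1)) : u 2 i * DU ≤ (U : ℝ) := by
  have hu := u_nonneg (d := 2) i
  have h' : ((DU : ℝ)) ^ 2 ≤ (U : ℝ) ^ 2 * (3 * (i : ℝ) + 1) := by exact_mod_cast h
  have hsq := u_two_sq_le i
  have hpos : (0 : ℝ) < 3 * (i : ℝ) + 1 := by positivity
  have h1 : (u 2 i * DU) ^ 2 ≤ (U : ℝ) ^ 2 := by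
    rw [mul_pow]
    calc u 2 i ^ 2 * (DU : ℝ) ^ 2 ≤ 1 / (3 * (i : ℝ) + 1) * ((U : ℝ) ^ 2 * (3 * (i : ℝ) + 1)) :=
          mul_le_mul hsq h' (by positivity) (by positivity)
      _ = (U : ℝ) ^ 2 := by field_simp
  exact (pow_le_pow_iff_left₀ (mul_nonneg hu (Nat.cast_nonneg DU)) (Nat.cast_nonneg U) two_ne_zero).1 h1

/-- Membership in the index window `[M, N)` as a list. -/
theorem mem_range'_of_le {M N i : ℕ} (hMN : M ≤ N) (h1 : M ≤ i) (h2 : i < N) : i ∈ List.range' M (N - M) := by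
  rw [List.mem_range'_1]; omega

/-- **The diagonal coefficients, hybrid form**: exact values (`OSM.vrow 2 M`) below `M`, the square check on `[M, N)`. -/
theorem u_two_hybrid {M N DU : ℕ} {U : List ℕ} (hMN : M ≤ N)
    (h1 : ∀ i ∈ List.range M, uqv (OSM.vrow 2 M) 2 i * DU ≤ (U.getD i 0 : ℚ))
    (h2 : ∀ i ∈ List.range' M (N - M), DU ^ 2 ≤ U.getD i 0 ^ 2 * (3 * i + 1)) :
    ∀ i < N, u 2 i * DU ≤ (U.getD i 0 : ℝ) := by
  intro i hi
  rcases Nat.lt_or_ge i M with h | h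
  · have hq := (Rat.cast_le (K := ℝ)).2 (h1 i (List.mem_range.2 h))
    push_cast at hq
    rwa [uqv_cast h.le] at hq
  · exact u_two_le_of_sq (h2 i (mem_range'_of_le hMN h hi))

/-- **The adjacent coefficients, hybrid form** (`cadj 2 i ≤ u 2 i` beyond the cut). -/
theorem cadj_two_hybrid {M N DU : ℕ} {C : List ℕ} (hMN : M ≤ N)
    (h1 : ∀ i ∈ List.range M, cadjqv (OSM.vrow 2 (M + 1)) 2 i * DU ≤ (C.getD i 0 : ℚ))
    (h2 : ∀ i ∈ List.range' M (N - M), DU ^ 2 ≤ C.getD i 0 ^ 2 * (3 * i + 1)) :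
    ∀ i < N, cadj 2 i * DU ≤ (C.getD i 0 : ℝ) := by
  intro i hi
  rcases Nat.lt_or_ge i M with h | h
  · have hq := (Rat.cast_le (K := ℝ)).2 (h1 i (List.mem_range.2 h))
    push_cast at hq
    rwa [cadjqv_cast (by omega)] at hq
  · have hle := (cadj_bounds (k := 2) le_rfl i).2
    exact (mul_le_mul_of_nonneg_right hle (Nat.cast_nonneg DU)).trans (u_two_le_of_sq (h2 i (mem_range'_of_le hMN h hi)))

/-- **The two-axes tail from a square check**: with `X = (2N+2)/((2N+1) 8a₁) + r^{2M}/(1-r²)/2` (`r = 1 - 4a₁`,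
`M ≤ N`), `X² ≤ (Tn/DG)² (3N+1)` gives the tail bound `Tn/DG` (using `u 2 N ≤ 1/√(3N+1)` and `r^{2N} ≤ r^{2M}`). -/
theorem tailBoundH_of_twoSqQ (ht : 2 ≤ t) {A0 A1 A2 DA : ℕ} (hDA : A0 + 2 * A1 + 2 * A2 = DA) (hA1 : 0 < A1)
    (hA4 : 4 * A1 + 2 * A2 ≤ DA) (hA4' : 4 * A1 < DA) {M N : ℕ} (hMN : M ≤ N) {Tn DG : ℕ}
    (h : ((2 * (N : ℚ) + 2) / ((2 * (N : ℚ) + 1) * (8 * ((A1 : ℚ) / DA))) +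
        (1 - 4 * ((A1 : ℚ) / DA)) ^ (2 * M) / (1 - (1 - 4 * ((A1 : ℚ) / DA)) ^ 2) / 2) ^ 2 ≤
      ((Tn : ℚ) / DG) ^ 2 * (3 * (N : ℚ) + 1)) :
    TailBoundH t 2 ((A1 : ℝ) / DA) ((A2 : ℝ) / DA) N ((Tn : ℝ) / DG) := by
  have hadm := adm_of_nat hDA hA1 hA4
  have ha1 := hadm.pos
  have hDAR : (0 : ℝ) < DA := by exact_mod_cast (by omega : 0 < DA)
  have ha : 4 * ((A1 : ℝ) / DA) < 1 := by
    rw [show 4 * ((A1 : ℝ) / DA) = (4 * A1 : ℝ) / DA by ring, div_lt_one hDAR]; exact_mod_cast hA4'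
  set a₁ : ℝ := (A1 : ℝ) / DA with ha₁
  set r : ℝ := 1 - 4 * a₁ with hr
  have hr0 : 0 ≤ r := by rw [hr]; linarith
  have hr1 : r < 1 := by rw [hr]; linarith
  have hr2 : 0 < 1 - r ^ 2 := by nlinarith
  set X : ℝ := (2 * (N : ℝ) + 2) / ((2 * (N : ℝ) + 1) * (8 * a₁)) + r ^ (2 * M) / (1 - r ^ 2) / 2 with hX
  have hX0 : 0 ≤ X := by positivity
  have h' := (Rat.cast_le (K := ℝ)).2 h
  push_cast at h'
  have hX' : X ^ 2 ≤ ((Tn : ℝ) / DG) ^ 2 * (3 * (N : ℝ) + 1) := by rw [hX, hr, ha₁]; exact h'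
  refine tailBound_two' hadm ht ha N ?_
  have huN := u_nonneg (d := 2) N
  have hT0 : 0 ≤ (Tn : ℝ) / DG := by positivity
  -- `u_N X ≤ Tn/DG`
  have hsq := u_two_sq_le N
  have hpos : (0 : ℝ) < 3 * (N : ℝ) + 1 := by positivity
  have h1 : (u 2 N * X) ^ 2 ≤ ((Tn : ℝ) / DG) ^ 2 := by
    rw [mul_pow]
    calc u 2 N ^ 2 * X ^ 2 ≤ 1 / (3 * (N : ℝ) + 1) * (((Tn : ℝ) / DG) ^ 2 * (3 * (N : ℝ) + 1)) :=
          mul_le_mul hsq hX' (by positivity) (by positivity)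
      _ = ((Tn : ℝ) / DG) ^ 2 := by field_simp
  have h2 : u 2 N * X ≤ (Tn : ℝ) / DG := (pow_le_pow_iff_left₀ (mul_nonneg huN hX0) hT0 two_ne_zero).1 h1
  -- the geometric term at exponent `2N ≤ 2M`-weakened
  have hgeo : r ^ (2 * N) ≤ r ^ (2 * M) := pow_le_pow_of_le_one hr0 hr1.le (by omega)
  calc u 2 N * (2 * (N : ℝ) + 2) / ((2 * (N : ℝ) + 1) * (8 * a₁)) + u 2 N * r ^ (2 * N) / (1 - r ^ 2) / 2
      ≤ u 2 N * (2 * (N : ℝ) + 2) / ((2 * (N : ℝ) + 1) * (8 * a₁)) + u 2 N * r ^ (2 * M) / (1 - r ^ 2) / 2 := by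
        gcongr
    _ = u 2 N * X := by rw [hX]; ring
    _ ≤ (Tn : ℝ) / DG := h2

end Summit.CriticalPhenomena.PercolationContinuityZ3.Theorems.Pcint.BSMX

end
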